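import Literature.Probability.Percolation.MarkedLoopBoundaryLawModule
import Literature.Probability.LatticeModels.TemperleyLiebPercolationHead
import HarnessLib

/-!
# Boundary span from stability of the laws under the Temperley–Lieb generators («BSPAN-STABILITY-CRITERION»)

Topic `Literature/Probability/Percolation`; generic-`k` layer of the marked-loop (Khristoforov–Smirnov) lineage; a rider on `MarkedLoopBoundaryLawModule.lean`
(«BOUNDARY-LAW-MODULE»: the home-arc boundary link-pattern law `lawLP z : LinkPattern (k+1) →₀ ℂ` of a `(k+1)`-point configuration space, ★★★
`bNonvanish_last_iff_span_lawLP` — boundary non-degeneracy ⟺ the laws of all `k`-marked domains span the planar Temperley–Lieb module) and on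
`LatticeModels/TemperleyLiebPercolationHead.lean` («TL-PERCOLATION-HEAD»: ★★ `span_eq_top_of_stable` — at loop weight `1` the span of a family stable under the
generators `e_j` and containing one vector of non-zero total mass is the whole planar module; Ridout–Saint-Aubin's Prop. 3.3 at `β = 1`).

For `k = 2m+1` marks (the planar module of `k + 1 = 2m+2` sites, generators `e_0, …, e_{2m}` acting on consecutive pairs of the points `u_1, …, u_k, z` read from the
home cut):

* `totalMass_lawLP` — the total mass of a boundary law is the number of configurations counted: `ε(lawLP z) = Σ_{q ∈ Pat₀} N_q(z)` (a natural number);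
  `totalMass_lawLP_ne_zero` — it is non-zero as soon as one pattern is realised at `z`;
* ★★★ `bNonvanish_of_laws_stable` / `bSpan_of_laws_stable` — **THE STABILITY CRITERION**: if for every generator `e_j` and every home-arc boundary mid-edge `z` of
  every `k`-marked domain the vector `e_j · lawLP z` lies in the span of the boundary laws (of all `k`-marked domains), and some pattern is realised at some boundary
  mid-edge of some domain, then `BNonvanish k` and `BSpan k` hold on the home arc (hence on every arc, «BSPAN-IFF-BNONVANISH» `bNonvanish_iff`).

So the boundary question behind door (U) (HOME `FINDING-TRIPOD-DOOR-U-TWO-CORNER.md`) is reduced to a LOCAL CLOSURE PROPERTY of the family of percolation boundary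
laws under Pearce–Rittenberg–de Gier–Nienhuis's moves — no rank computation, no triangular family. The closure itself (a «plaquette» / hexagon-tower surgery on marked
domains, HOME `FINDING-BSPAN-TOWER-IDENTITY.md` of this seat) is NOT in this file.

## References
* M. Khristoforov, S. Smirnov, *Percolation and O(1) loop model*, arXiv:2111.15612 (2021), §1.2 (arXiv v1 p. 2: the law of the link pattern), §2 Definition 3 and
  Lemma 4 (p. 4), eq. (4) and Remark 6 (p. 5).
* D. Ridout, Y. Saint-Aubin, *Standard modules, induction and the structure of the Temperley–Lieb algebra*, Adv. Theor. Math. Phys. 18 (2014) 957–1041 =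
  arXiv:1204.4505, §3 Prop. 3.3 (arXiv p. 13).
* P. A. Pearce, V. Rittenberg, J. de Gier, B. Nienhuis, *Temperley–Lieb stochastic processes*, J. Phys. A 35 (2002) L661–L668, §2.

## Mathlib / tree
Tree: `MarkedLoopBoundaryLawModule` (`lawLP`, `lawLP_apply_pat₀`, `bNonvanish_last_iff_span_lawLP`), `MarkedLoopBoundarySpan` (`ArcPoint`, `BNonvanish`, `BSpan`,
`bSpan_iff_bNonvanish`), `LatticeModels/TemperleyLiebPercolationHead` (`totalMass`, `span_eq_top_of_stable`), `MarkedLoopTemperleyLiebCoords` (`pat₀EquivLinkPattern`),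
`MarkedLoopTripodBasis` (`Pat₀`, `patternCount`). Mathlib: `Finsupp.linearCombination_apply`, `Finsupp.sum_fintype`, `Equiv.sum_comp`, `Finset.single_le_sum`.
-/

open Finset

namespace Literature.Probability.Percolation.MarkedLoops

open Literature.Probability.Percolation Literature.Probability.LatticeModels
open Literature.Probability.LatticeModels.TemperleyLieb
open TriMarkedDomain

section Criterion

variable {m : ℕ}

/-- ★ **the total mass of a boundary law is the number of configurations it counts**: `ε(lawLP z) = Σ_{q ∈ Pat₀} N_q(z)`.
[cite: KhristoforovSmirnov2021, §1.2 (arXiv v1 p. 2: the law of the link pattern); PearceRittenbergDeGierNienhuis2002, §2] -/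
theorem totalMass_lawLP {D : TriMarkedDomain (2 * m + 1)} (z : ArcPoint D (Fin.last (2 * m))) :
    totalMass ℂ (lawLP z) = ((∑ q : Pat₀ (2 * m + 1), patternCount D z.v z.i q.1 : ℕ) : ℂ) := by
  rw [totalMass, Finsupp.linearCombination_apply, Finsupp.sum_fintype _ _ (fun Q => by rw [zero_smul]), Nat.cast_sum,
    ← (pat₀EquivLinkPattern (2 * m + 1)).sum_comp]
  refine Finset.sum_congr rfl fun q _ => ?_
  rw [smul_eq_mul, mul_one, lawLP_apply_pat₀]

/-- ★ **a boundary law realising some pattern has non-zero total mass.** [cite: KhristoforovSmirnov2021, §1.2 (arXiv v1 p. 2)] -/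
theorem totalMass_lawLP_ne_zero {D : TriMarkedDomain (2 * m + 1)} (z : ArcPoint D (Fin.last (2 * m))) {q : Pat₀ (2 * m + 1)}
    (hq : patternCount D z.v z.i q.1 ≠ 0) : totalMass ℂ (lawLP z) ≠ 0 := by
  rw [totalMass_lawLP, Nat.cast_ne_zero]
  have hle : patternCount D z.v z.i q.1 ≤ ∑ q' : Pat₀ (2 * m + 1), patternCount D z.v z.i q'.1 :=
    Finset.single_le_sum (f := fun q' : Pat₀ (2 * m + 1) => patternCount D z.v z.i q'.1) (fun _ _ => Nat.zero_le _) (Finset.mem_univ q)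
  omega

/-- ★★★ **THE STABILITY CRITERION FOR BOUNDARY NON-DEGENERACY** (`k = 2m+1` marks, home arc): if the span of the boundary link-pattern laws of all `k`-marked domains
is stable under every Temperley–Lieb generator at loop weight `1`, and some pattern is realised at some home-arc boundary mid-edge of some `k`-marked domain, then no
non-zero tripod-law solution has an observable vanishing on the home arc of every domain. [cite: KhristoforovSmirnov2021, §2 Lemma 4 (arXiv v1 p. 4), eq. (4) and Remark 6 (p. 5); RidoutSaintAubin2014TL, §3 Prop. 3.3 (arXiv p. 13); PearceRittenbergDeGierNienhuis2002, §2] -/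
theorem bNonvanish_of_laws_stable
    (hstab : ∀ (j : Fin (2 * m + 1)) (D : TriMarkedDomain (2 * m + 1)) (z : ArcPoint D (Fin.last (2 * m))),
      tlL ℂ 1 j (lawLP z) ∈ Submodule.span ℂ (Set.range fun zz : (Σ D : TriMarkedDomain (2 * m + 1), ArcPoint D (Fin.last (2 * m))) => lawLP zz.2))
    (h0 : ∃ (D : TriMarkedDomain (2 * m + 1)) (z : ArcPoint D (Fin.last (2 * m))) (q : Pat₀ (2 * m + 1)), patternCount D z.v z.i q.1 ≠ 0) :
    BNonvanish (2 * m + 1) (Fin.last (2 * m)) := by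
  obtain ⟨D₀, z₀, q₀, hq₀⟩ := h0
  rw [bNonvanish_last_iff_span_lawLP]
  exact span_eq_top_of_stable (fun zz : (Σ D : TriMarkedDomain (2 * m + 1), ArcPoint D (Fin.last (2 * m))) => lawLP zz.2)
    (fun j zz => hstab j zz.1 zz.2) (i₀ := ⟨D₀, z₀⟩) (totalMass_lawLP_ne_zero z₀ hq₀)

/-- ★★★ **… AND FOR BOUNDARY SPAN**: under the same hypotheses the boundary count vectors span `ℂ^{outAt}` on the home arc.
[cite: KhristoforovSmirnov2021, §2 eq. (4) and Remark 6 (arXiv v1 p. 5); RidoutSaintAubin2014TL, §3 Prop. 3.3 (arXiv p. 13)] -/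
theorem bSpan_of_laws_stable
    (hstab : ∀ (j : Fin (2 * m + 1)) (D : TriMarkedDomain (2 * m + 1)) (z : ArcPoint D (Fin.last (2 * m))),
      tlL ℂ 1 j (lawLP z) ∈ Submodule.span ℂ (Set.range fun zz : (Σ D : TriMarkedDomain (2 * m + 1), ArcPoint D (Fin.last (2 * m))) => lawLP zz.2))
    (h0 : ∃ (D : TriMarkedDomain (2 * m + 1)) (z : ArcPoint D (Fin.last (2 * m))) (q : Pat₀ (2 * m + 1)), patternCount D z.v z.i q.1 ≠ 0) :
    BSpan (2 * m + 1) (Fin.last (2 * m)) :=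
  (bSpan_iff_bNonvanish _).2 (bNonvanish_of_laws_stable hstab h0)

/-- ★★ **every arc** (`k = 2m+3 ≥ 3` marks): the same criterion, read on the home arc, gives boundary non-degeneracy and span on ANY arc.
[cite: KhristoforovSmirnov2021, §1.2 (arXiv v1 p. 2: cyclic indexing); §2 eq. (4) (p. 5); RidoutSaintAubin2014TL, §3 Prop. 3.3 (arXiv p. 13)] -/
theorem bSpan_of_laws_stable' {m : ℕ}
    (hstab : ∀ (j : Fin (2 * (m + 1) + 1)) (D : TriMarkedDomain (2 * (m + 1) + 1)) (z : ArcPoint D (Fin.last (2 * (m + 1)))),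
      tlL ℂ 1 j (lawLP z) ∈ Submodule.span ℂ (Set.range fun zz : (Σ D : TriMarkedDomain (2 * (m + 1) + 1), ArcPoint D (Fin.last (2 * (m + 1)))) => lawLP zz.2))
    (h0 : ∃ (D : TriMarkedDomain (2 * (m + 1) + 1)) (z : ArcPoint D (Fin.last (2 * (m + 1)))) (q : Pat₀ (2 * (m + 1) + 1)), patternCount D z.v z.i q.1 ≠ 0)
    (a : Fin (2 * (m + 1) + 1)) : BSpan (2 * (m + 1) + 1) a ∧ BNonvanish (2 * (m + 1) + 1) a := by
  have h := bNonvanish_of_laws_stable hstab h0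
  have ha : BNonvanish (2 * (m + 1) + 1) a := (bNonvanish_iff (n := 2 * m + 1) a (Fin.last (2 * (m + 1)))).2 h
  exact ⟨(bSpan_iff_bNonvanish a).2 ha, ha⟩

end Criterion

end Literature.Probability.Percolation.MarkedLoops
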